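import Literature.AlgebraicGeometry.HodgeTheory.CyclicCoverMeridianMonodromy
import Literature.AlgebraicGeometry.HodgeTheory.CyclicCoverBaseChart
import Literature.AlgebraicGeometry.HodgeTheory.CyclicReflectionSystemOfMeridians
import Literature.AlgebraicGeometry.HodgeTheory.QbarFamilyLocalSystem
import Literature.AlgebraicGeometry.HodgeTheory.SymmetricHypersurfaceInvolution
import Literature.AlgebraicGeometry.HodgeTheory.DiagonalSymmetryGysinEquivariance
import Literature.AlgebraicGeometry.Motives.MonomialSupportedHypersurfaceSymmetry
import Literature.AlgebraicGeometry.FundamentalGroup.HypersurfaceComplementMeridianExists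
import Literature.AlgebraicGeometry.FundamentalGroup.HypersurfaceComplementMeridiansGenerate
import Summits.HodgeConjecture.HodgeConjecture.Theorems.SignSymmetricPowersMeridianMonodromy
import Summits.HodgeConjecture.HodgeConjecture.Theorems.CyclicUnitaryPowersThreePrintFacts
import HarnessLib

/-!
# Crux K1-A input PL_A DERIVED: the Picard–Lefschetz package `carlsonToledo1999_cyclicReflectionSystem` of
# the universal family of cyclic covers from the LOCAL meridian facts (route `CyclicUnitaryPowers`,
# item stmt-HodgeConjecture-19544)

Prover seat `hodge-nonav-prover-Bx` (g8), cell `hodge-nonav`. Landed `--supports stmt-HodgeConjecture-19544`;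
sorry-free, no definition, no new named fact. CONDITIONAL on the two cited facts of
`Literature/AlgebraicGeometry/HodgeTheory/CyclicCoverMeridianMonodromy.lean`; nothing here says HC ∕ HC_AV is
proved; rung F-H1 is not moved.

The registered binder `stub_carlsonToledoFamily` of crux K1 (`VeryGeneralDeckCommutatorsInHg`) is the bundled cited
fact `nonempty_carlsonToledoFamily`, reduced by `CyclicCoverUniversalFamily` to `carlsonToledo1999_cyclicReflectionSystem`
(CT99 §2 identification + §3 Zariski–van Kampen generation + §6 local cyclic reflections + §7 one orbit and spanning,
for the CONSTRUCTED family `cyclicCoverFamily p`). This file proves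

* `carlsonToledo1999_cyclicReflectionSystem_of_meridian_facts` —
  **`carlsonToledo1999_meridianMonodromy_isCyclicReflection → carlsonToledo1999_monodromyInvariants_eq_deckInvariants →
  carlsonToledo1999_cyclicReflectionSystem`**, hence `nonempty_carlsonToledoFamily_of_meridian_facts`.

The §3/§7 content is supplied by THEOREMS: Zariski–van Kampen generation
(`affineHypersurfaceComplement_meridians_normalClosure_eq_top_holds`) and meridian conjugacy
(`affineHypersurfaceComplement_meridian_isConj_holds`) on the coefficient chart of the base
(`CyclicCoverBaseChart`: `S(ℂ) ≃ₜ {Disc₃ ≠ 0}`, the ternary discriminant being irreducible), a meridian to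
generate from (`nonempty_meridian_of_irreducible`), the monodromy representation on `π₁`
(`SignSymmetricPowersMeridianMonodromy.exists_monodromyHom`), and the linear algebra of
`CyclicReflectionSystemOfMeridians` (one orbit from `V_γ = range(T_γ − 1)`; spanning from "invariants are
`τ`-invariant"). §1 here: the identification `e : 𝒴_{[F]} ≅ X_F` compatible with the embeddings into `ℙ³`
EXISTS (port of `exists_fiberIsoM_comp_hypersurfaceι`) and the covering automorphism `τ = e^* ∘ σ_F^* ∘ (e^*)⁻¹`
is a `B`-isometry (`tr_cup_pull_diagonalAut`).

## References

* [CarlsonToledo1999] J. A. Carlson, D. Toledo, Duke Math. J. 97 (1999), §1, §2, §3, §6 Proposition, §7.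
* [Shimada2010ZvK] I. Shimada, arXiv:0906.1074, §3 Prop. 3.4.
* [VoisinHodgeII2003] C. Voisin, Hodge Theory and Complex Algebraic Geometry II, §3.1.2, §6.2.1.
-/

noncomputable section

set_option linter.dupNamespace false

open CategoryTheory MvPolynomial _root_.Topology
open Literature.AlgebraicTopology.SingularHomology
open Literature.AlgebraicGeometry.Motives Literature.AlgebraicGeometry.Motives.UniversalHypersurface
open Literature.AlgebraicGeometry.HodgeTheory Literature.AlgebraicGeometry.HodgeTheory.UniversalHypersurface
open Literature.AlgebraicGeometry.FundamentalGroup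
open Summit.HodgeConjecture.HodgeConjecture.Theorems.SignSymmetricPowersMeridianMonodromy

namespace Summit.HodgeConjecture.HodgeConjecture.Theorems.CyclicUnitaryPowersPLPackageOfMeridians

/-! ### §1 The identification of the fibre with the model, compatible with the embeddings into `ℙ³` -/

section FibreIso

variable (p : ℕ) [NeZero p]

/-- The form of the classifying point `[x₃^p − f]` is `x₃^p − f`. [cite: CarlsonToledo1999, §2 (held text p0004)] -/
theorem pointFormSpz_cyclicCoverPoint {f : MvPolynomial (Fin 3) ℂ} (hf : f.IsHomogeneous p)
    (hJ : SmoothHypersurface.IsNonsingularForm ℂ (cyclicCoverForm p f)) :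
    pointFormSpz ℂ 2 p (cyclicCoverSpz p) (cyclicCoverPoint p f) = cyclicCoverForm p f := by
  rw [cyclicCoverPoint_eq p hf hJ]
  exact pointFormSpz_pointOfFormSpz ℂ 2 p _ _ hJ _

/-- The fibre of the Carlson–Toledo family over any point `t` is the hypersurface of ANY form `G` equal to the
form of `t`, compatibly with the embeddings into `ℙ³` (base change of `exists_fiberIso_comp_hypersurfaceι`; the
equation `F_t = G` is substituted, no cast). [cite: VoisinHodgeII2003, §6.2.1] -/
theorem exists_fiberIso_comp_hypersurfaceι_of_eq (t : ComplexPoints (cyclicCoverBase p))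
    {G : MvPolynomial (Fin 4) ℂ} (hG : pointFormSpz ℂ 2 p (cyclicCoverSpz p) t = G) :
    ∃ e : fiberOver (cyclicCoverFamily p) t ≅ SmoothHypersurface.hypersurface G,
      e.hom ≫ SmoothHypersurface.hypersurfaceι G =
        fiberι (cyclicCoverFamily p) t ≫ totalSpzToTotal ℂ 2 p (cyclicCoverSpz p) ≫
          Literature.AlgebraicGeometry.HodgeTheory.UniversalHypersurface.toProjectiveSpace ℂ 2 p := by
  subst hG
  have hp : 0 < p := Nat.pos_of_ne_zero (NeZero.ne p)
  obtain ⟨e₀, he₀⟩ := exists_fiberIso_comp_hypersurfaceι ℂ 2 p hp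
    (AlgPoints.map (toBaseSpz ℂ 2 p (cyclicCoverSpz p)) t)
  refine ⟨fiberOverFamilyPullbackIso (family ℂ 2 p) (toBaseSpz ℂ 2 p (cyclicCoverSpz p)) t ≪≫ e₀, ?_⟩
  have h1 := fiberOverFamilyPullbackIso_hom_fiberι (family ℂ 2 p) (toBaseSpz ℂ 2 p (cyclicCoverSpz p)) t
  rw [Iso.trans_hom, Category.assoc, he₀, ← Category.assoc]
  change ((fiberOverFamilyPullbackIso (family ℂ 2 p) (toBaseSpz ℂ 2 p (cyclicCoverSpz p)) t).hom ≫
      fiberι (family ℂ 2 p) (AlgPoints.map (toBaseSpz ℂ 2 p (cyclicCoverSpz p)) t)) ≫ _ =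
    fiberι (familyPullback.snd (family ℂ 2 p) (toBaseSpz ℂ 2 p (cyclicCoverSpz p))) t ≫
      familyPullback.fst (family ℂ 2 p) (toBaseSpz ℂ 2 p (cyclicCoverSpz p)) ≫ _
  rw [h1, Category.assoc]

/-- **The fibre of the Carlson–Toledo family over `[F]` is `X_F`, compatibly with the embeddings into `ℙ³`**
(`IsCompatibleFibreIso`). [cite: CarlsonToledo1999, §2 (universalcyclic) (held text p0004–p0005)] [cite: VoisinHodgeII2003, §6.2.1] -/
theorem exists_isCompatibleFibreIso {f : MvPolynomial (Fin 3) ℂ} (hf : f.IsHomogeneous p)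
    (hJ : SmoothHypersurface.IsNonsingularForm ℂ (cyclicCoverForm p f)) :
    ∃ e : fiberOver (cyclicCoverFamily p) (cyclicCoverPoint p f) ≅
        SmoothHypersurface.hypersurface (cyclicCoverForm p f), IsCompatibleFibreIso p e :=
  exists_fiberIso_comp_hypersurfaceι_of_eq p (cyclicCoverPoint p f) (pointFormSpz_cyclicCoverPoint p hf hJ)

end FibreIso

/-! ### §2 The covering automorphism on the fibre and its isometry -/

section Deck

variable {p : ℕ} {f : MvPolynomial (Fin 3) ℂ}

/-- `σ_F^*` as a linear automorphism of `H²(X_F(ℂ); ℚ)` (`σ_F = diagonalAut F ha` has the inverse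
`diagonalAut F (a⁻¹)`). [cite: CarlsonToledo1999, §2 (held text p0005)] -/
theorem exists_deckEquiv_model (ha : deckUnit p ∈ diagonalStabilizer (cyclicCoverForm p f)) :
    ∃ σ : bettiCohomology (SmoothHypersurface.hypersurface (cyclicCoverForm p f)) 2 ≃ₗ[ℚ]
        bettiCohomology (SmoothHypersurface.hypersurface (cyclicCoverForm p f)) 2,
      ∀ x, σ x = BettiUniverse.pull (diagonalAut (cyclicCoverForm p f) ha) 2 x := by
  refine ⟨LinearEquiv.ofLinear (BettiUniverse.pull (diagonalAut (cyclicCoverForm p f) ha) 2)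
    (BettiUniverse.pull (diagonalAut (cyclicCoverForm p f) (inv_mem ha)) 2)
    (BettiUniverse.pull_comp_pull_of_comp_eq_id (diagonalAut_comp_inv (cyclicCoverForm p f) ha) 2)
    (BettiUniverse.pull_comp_pull_of_comp_eq_id (diagonalAut_inv_comp (cyclicCoverForm p f) ha) 2), fun x => rfl⟩

/-- **The covering automorphism `τ` of `H²(𝒴_{[F]}; ℚ)` matched with `σ_F^*` by an identification `e`**:
`τ = (e⁻¹)^{*-1} ∘ σ_F^* ∘ (e⁻¹)^*`, so that `(e⁻¹)^* (τ x) = σ_F^* ((e⁻¹)^* x)`. [cite: CarlsonToledo1999, §2 (held text p0005)] -/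
theorem exists_deck_intertwining [NeZero p]
    (e : fiberOver (cyclicCoverFamily p) (cyclicCoverPoint p f) ≅
      SmoothHypersurface.hypersurface (cyclicCoverForm p f)) :
    ∃ τ : bettiCohomology (fiberOver (cyclicCoverFamily p) (cyclicCoverPoint p f)) 2 ≃ₗ[ℚ]
        bettiCohomology (fiberOver (cyclicCoverFamily p) (cyclicCoverPoint p f)) 2,
      ∀ (ha : deckUnit p ∈ diagonalStabilizer (cyclicCoverForm p f))
        (x : bettiCohomology (fiberOver (cyclicCoverFamily p) (cyclicCoverPoint p f)) 2),
        BettiUniverse.pullEquiv e 2 (τ x) =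
          BettiUniverse.pull (diagonalAut (cyclicCoverForm p f) ha) 2 (BettiUniverse.pullEquiv e 2 x) := by
  have ha₀ : deckUnit p ∈ diagonalStabilizer (cyclicCoverForm p f) :=
    deckUnit_mem_diagonalStabilizer (NeZero.ne p) f
  obtain ⟨σ, hσ⟩ := exists_deckEquiv_model ha₀
  refine ⟨(BettiUniverse.pullEquiv e 2).trans (σ.trans (BettiUniverse.pullEquiv e 2).symm), fun ha x => ?_⟩
  rw [LinearEquiv.trans_apply, LinearEquiv.trans_apply, LinearEquiv.apply_symm_apply, hσ]

/-- **`τ` is an isometry of the cup form `B = transportedTraceForm hX e 2`** (the deck transformation of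
the model preserves `tr(x ∪ y)`, `tr_cup_pull_diagonalAut`). [cite: CarlsonToledo1999, §2 (held text p0005)] -/
theorem transportedTraceForm_deck [NeZero p] (hX : IsSmoothProjective 2 (SmoothHypersurface.hypersurface (cyclicCoverForm p f)))
    (e : fiberOver (cyclicCoverFamily p) (cyclicCoverPoint p f) ≅
      SmoothHypersurface.hypersurface (cyclicCoverForm p f))
    {τ : bettiCohomology (fiberOver (cyclicCoverFamily p) (cyclicCoverPoint p f)) 2 ≃ₗ[ℚ]
      bettiCohomology (fiberOver (cyclicCoverFamily p) (cyclicCoverPoint p f)) 2}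
    (hτ : ∀ (ha : deckUnit p ∈ diagonalStabilizer (cyclicCoverForm p f))
      (x : bettiCohomology (fiberOver (cyclicCoverFamily p) (cyclicCoverPoint p f)) 2),
      BettiUniverse.pullEquiv e 2 (τ x) =
        BettiUniverse.pull (diagonalAut (cyclicCoverForm p f) ha) 2 (BettiUniverse.pullEquiv e 2 x))
    (x y : bettiCohomology (fiberOver (cyclicCoverFamily p) (cyclicCoverPoint p f)) 2) :
    transportedTraceForm hX e 2 (τ x) (τ y) = transportedTraceForm hX e 2 x y := by
  have ha₀ : deckUnit p ∈ diagonalStabilizer (cyclicCoverForm p f) :=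
    deckUnit_mem_diagonalStabilizer (NeZero.ne p) f
  rw [transportedTraceForm_apply, transportedTraceForm_apply, hτ ha₀, hτ ha₀,
    tr_cup_pull_diagonalAut (cyclicCoverForm p f) hX ha₀]

end Deck

/-! ### §3 Meridians: conjugates of meridian classes are meridian classes -/

section Meridians

variable {ι : Type} [Fintype ι] {m : ℕ} {h : Fin m → MvPolynomial ι ℂ}
  {s : affineHypersurfaceComplement h} {j : Fin m}

/-- **Conjugates of meridian classes are meridian classes**: for `κ ∈ π₁(U, s)` represented by a loop `q`
and a meridian `μ`, the meridian with leash `q⁻¹ · leash` has class `κ [μ] κ⁻¹` (change of base point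
along a loop, `Meridian.pathConj_loopClass`). [cite: Shimada2010ZvK, §3 (leashed discs)] [cite: HatcherAT2002, §1.1 Prop. 1.5] -/
theorem exists_meridian_loopClass_eq_conj (κ : FundamentalGroup (affineHypersurfaceComplement h) s)
    (μ : Meridian h s j) : ∃ μ' : Meridian h s j, μ'.loopClass = κ * μ.loopClass * κ⁻¹ := by
  induction κ using Path.Homotopic.Quotient.ind with | mk q => ?_
  refine ⟨μ.precomp q.symm, ?_⟩
  rw [← Meridian.pathConj_loopClass]
  change FundamentalGroup.fromPath (Path.Homotopic.Quotient.mk (q.symm.trans (μ.loop.trans q.symm.symm))) =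
    FundamentalGroup.fromPath (Path.Homotopic.Quotient.mk (q.symm.trans (μ.loop.trans q)))
  rw [Path.symm_symm]

/-- **All meridian classes of an irreducible hypersurface generate `π₁` of the complement** (as a plain
subgroup, not only normally): Zariski–van Kampen gives the normal closure of ONE meridian class
(`affineHypersurfaceComplement_meridians_normalClosure_eq_top_holds`, `nonempty_meridian_of_irreducible`), and
every conjugate of a meridian class is a meridian class. [cite: Shimada2010ZvK, §3 Prop. 3.4] -/
theorem closure_meridian_loopClasses_eq_top {g : MvPolynomial ι ℂ} (hg : Irreducible g)
    (s : affineHypersurfaceComplement ![g]) :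
    Subgroup.closure {c | ∃ μ : Meridian ![g] s 0, c = μ.loopClass} = ⊤ := by
  obtain ⟨μ₀⟩ := nonempty_meridian_of_irreducible hg s
  have hirr : ∀ j : Fin 1, Irreducible ((![g] : Fin 1 → MvPolynomial ι ℂ) j) := fun j => by
    fin_cases j; exact hg
  have hZ := affineHypersurfaceComplement_meridians_normalClosure_eq_top_holds ι 1 ![g] hirr s
    (Fin.cases μ₀ fun i => i.elim0)
  rw [eq_top_iff, ← hZ, Subgroup.normalClosure]
  refine Subgroup.closure_mono fun x hx => ?_
  obtain ⟨a, ⟨j, rfl⟩, hconj⟩ := Group.mem_conjugatesOfSet_iff.mp hx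
  obtain ⟨c, rfl⟩ := isConj_iff.mp hconj
  fin_cases j
  obtain ⟨μ', hμ'⟩ := exists_meridian_loopClass_eq_conj c μ₀
  exact ⟨μ', by rw [hμ']; rfl⟩

end Meridians

/-! ### §4 The package from the meridian facts -/

section Assembly

variable {p : ℕ} [NeZero p]

/-- Transport in `R² u_* ℂ` of the Carlson–Toledo family preserves rational classes (smooth projective family
over the smooth quasi-projective base `S ⊆ 𝔸^{N+1}`). [cite: VoisinHodgeII2003, §3.1.2] -/
theorem isRationalClass_transportFun_cyclicCoverFamily
    (s t : (Set.univ : Set (ComplexPoints (cyclicCoverBase p)))) (γ : Path.Homotopic.Quotient s t)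
    (α : complexBetti (fiberOver (cyclicCoverFamily p) s.1) 2) (hα : IsRationalClass α) :
    IsRationalClass (transportFun (cyclicCoverFamily p) 2 (cyclicCoverFamily_locallyTrivial p) γ α) := by
  haveI := smoothOfRelativeDimension_baseSpz_hom ℂ 2 p (cyclicCoverSpz p)
  exact isRationalClass_transportFun_of_isSmoothProjectiveFamily (cyclicCoverFamily p) 2
    (0 + Nat.card (TernaryIndex p)) (isSmoothProjectiveFamily_cyclicCoverFamily p)
    (isQuasiProjectiveOver_baseSpz 2 p (cyclicCoverSpz p)) γ hα

/-- **PL_A from the meridian facts.** The bundled Picard–Lefschetz package of the universal family of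
`p`-cyclic covers of the plane (`carlsonToledo1999_cyclicReflectionSystem`: CT99 §2 + §3 + §6 + §7) FOLLOWS from
the local meridian fact (§1 + §6 Proposition) and the invariant-cycle fact (§3 ¶2): the identification `e` and the
covering automorphism `τ` are constructed (§1–§2 here); the set `𝓜` of meridian reflections generates the
monodromy group (Zariski–van Kampen on the coefficient chart, through the monodromy representation on `π₁`), its
elements are pairwise conjugate up to inversion (meridian conjugacy), and `nonempty_cyclicReflectionSystem_of_meridians'`
assembles the `CyclicReflectionSystem`. CONDITIONAL on the two cited facts; nothing here says HC ∕ HC_AV is proved.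
[cite: CarlsonToledo1999, §2, §3, §6 Proposition, §7 last paragraph] [cite: Shimada2010ZvK, §3 Prop. 3.4] -/
theorem carlsonToledo1999_cyclicReflectionSystem_of_meridian_facts
    (H1 : carlsonToledo1999_meridianMonodromy_isCyclicReflection)
    (H2 : carlsonToledo1999_monodromyInvariants_eq_deckInvariants) :
    carlsonToledo1999_cyclicReflectionSystem := by
  intro p _ hodd h3 f hf hf0 hX
  have hp2 : 2 ≤ p := by omega
  have hp0 : p ≠ 0 := by omega
  have hJ := CyclicCoverFormNonsingular.isNonsingularForm_cyclicCoverForm_of_isSmoothProjective hp2 hf hf0 hX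
  -- §1–§2: the identification and the covering automorphism
  obtain ⟨e, he⟩ := exists_isCompatibleFibreIso p hf hJ
  obtain ⟨τ, hτ⟩ := exists_deck_intertwining e
  refine ⟨e, τ, hτ, ?_⟩
  have hBs : (transportedTraceForm hX e 2).IsSymm := transportedTraceForm_isSymm hX e (by decide)
  have hBnd : (transportedTraceForm hX e 2).Nondegenerate := transportedTraceForm_nondegenerate hX e
  have hBτ : ∀ x y, transportedTraceForm hX e 2 (τ x) (τ y) = transportedTraceForm hX e 2 x y :=
    transportedTraceForm_deck hX e hτ
  -- the coefficient chart of the base and an irreducible equation of the discriminant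
  obtain ⟨D, hDirr, hDeq⟩ := exists_irreducible_discriminantEquation p hp2
  obtain ⟨χ, hχ⟩ := exists_homeomorph_affineHypersurfaceComplement p hDeq
  have hDeq' : IsDiscriminantEquation p D := hDeq
  have hχ' : IsCoefficientChart p D χ := hχ
  have hirr : ∀ j : Fin 1, Irreducible ((![D] : Fin 1 → MvPolynomial (TernaryIndex p) ℂ) j) := fun j => by
    fin_cases j; exact hDirr
  -- base points and the pointed homeomorphism `Set.univ ≃ₜ {D ≠ 0}`
  let s₀ : ComplexPoints (cyclicCoverBase p) := cyclicCoverPoint p f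
  let u₀ : (Set.univ : Set (ComplexPoints (cyclicCoverBase p))) := ⟨s₀, Set.mem_univ _⟩
  let Ψ : (Set.univ : Set (ComplexPoints (cyclicCoverBase p))) ≃ₜ affineHypersurfaceComplement ![D] :=
    (Homeomorph.Set.univ _).trans χ
  have hΨ : Ψ.symm (χ s₀) = u₀ := by
    rw [Homeomorph.symm_apply_eq]
    rfl
  let φ := FundamentalGroup.mapOfEq (Ψ.symm : C(affineHypersurfaceComplement ![D],
    (Set.univ : Set (ComplexPoints (cyclicCoverBase p))))) hΨ
  have hφsurj : Function.Surjective φ := mapOfEq_surjective_of_homeomorph Ψ.symm hΨ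
  -- the monodromy representation on `π₁(Set.univ, u₀)`
  obtain ⟨ρ, hρ, hrange⟩ := exists_monodromyHom (cyclicCoverFamily p) 2 (cyclicCoverFamily_locallyTrivial p)
    (isRationalClass_transportFun_cyclicCoverFamily) u₀
  -- reading a meridian loop back in `S(ℂ)`
  have hread : ∀ μ : Meridian ![D] (χ s₀) 0, ∃ γ : Path s₀ s₀, (∀ θ, χ (γ θ) = μ.loop θ) ∧
      FundamentalGroup.toPath (φ μ.loopClass) = cyclicCoverLoopClass p γ := by
    intro μ
    have hx : s₀ = χ.symm (χ s₀) := (χ.symm_apply_apply s₀).symm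
    refine ⟨(μ.loop.map χ.symm.continuous).cast hx hx, fun θ => ?_, ?_⟩
    · change χ (χ.symm (μ.loop θ)) = μ.loop θ
      exact χ.apply_symm_apply _
    · dsimp only [φ]
      erw [Meridian.loopClass_def, mapOfEq_fromPath_mk]
      change Path.Homotopic.Quotient.mk _ = Path.Homotopic.Quotient.mk _
      congr 1
  -- the meridian reflections: `T_μ = ρ (φ [μ])` and `r_μ ∈ {T_μ, T_μ⁻¹}` the cyclic reflection (H1)
  have hmer : ∀ μ : Meridian ![D] (χ s₀) 0,
      ∃ (r : bettiCohomology (fiberOver (cyclicCoverFamily p) (cyclicCoverPoint p f)) 2 ≃ₗ[ℚ]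
          bettiCohomology (fiberOver (cyclicCoverFamily p) (cyclicCoverPoint p f)) 2)
        (δ : bettiCohomology (fiberOver (cyclicCoverFamily p) (cyclicCoverPoint p f)) 2),
        (r = ρ (φ μ.loopClass) ∨ r = (ρ (φ μ.loopClass))⁻¹) ∧
        δ ≠ 0 ∧ (∑ i ∈ Finset.range p, (τ ^ i) δ) = 0 ∧ Module.finrank ℚ (cyclicSpan τ δ) = p - 1 ∧
        (∀ x ∈ cyclicSpan τ δ, (∀ y ∈ cyclicSpan τ δ, transportedTraceForm hX e 2 x y = 0) → x = 0) ∧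
        IsCyclicReflection (transportedTraceForm hX e 2) τ δ r := by
    intro μ
    obtain ⟨γ, hγ, hcls⟩ := hread μ
    obtain ⟨T, r, δ, hT, hrT, -, h0, hΦ, hdim, hnd, hrefl⟩ :=
      H1.exists_reflection_mem_ratMonodromyGroup hodd h3 hf hf0 hX he hτ hDirr hDeq' hχ' μ γ hγ
    have hTρ : ρ (φ μ.loopClass) = T := by
      refine isRatTransport_unique (cyclicCoverFamily p) 2 (cyclicCoverFamily_locallyTrivial p) (hρ _) ?_
      rw [hcls]
      exact hT
    rw [hTρ]
    exact ⟨r, δ, hrT, h0, hΦ, hdim, hnd, hrefl⟩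
  -- the set of meridian reflections
  let 𝓜 : Set (bettiCohomology (fiberOver (cyclicCoverFamily p) (cyclicCoverPoint p f)) 2 ≃ₗ[ℚ]
      bettiCohomology (fiberOver (cyclicCoverFamily p) (cyclicCoverPoint p f)) 2) :=
    {r | ∃ μ : Meridian ![D] (χ s₀) 0, (r = ρ (φ μ.loopClass) ∨ r = (ρ (φ μ.loopClass))⁻¹) ∧
      ∃ δ : bettiCohomology (fiberOver (cyclicCoverFamily p) (cyclicCoverPoint p f)) 2,
        δ ≠ 0 ∧ (∑ i ∈ Finset.range p, (τ ^ i) δ) = 0 ∧ Module.finrank ℚ (cyclicSpan τ δ) = p - 1 ∧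
        (∀ x ∈ cyclicSpan τ δ, (∀ y ∈ cyclicSpan τ δ, transportedTraceForm hX e 2 x y = 0) → x = 0) ∧
        IsCyclicReflection (transportedTraceForm hX e 2) τ δ r}
  have hρmem : ∀ c, ρ c ∈ ratMonodromyGroup (cyclicCoverFamily p) 2 (cyclicCoverFamily_locallyTrivial p) u₀ :=
    fun c => hrange ▸ ⟨c, rfl⟩
  haveI : Module.Finite ℚ (bettiCohomology (fiberOver (cyclicCoverFamily p) (cyclicCoverPoint p f)) 2) :=
    BettiUniverse.finite ((isSmoothProjectiveFamily_cyclicCoverFamily p).isSmoothProjective (cyclicCoverPoint p f)) 2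
  refine nonempty_cyclicReflectionSystem_of_meridians' hBs hBnd hBτ hp0 (𝓜 := 𝓜) ?_ ?_ ?_ ?_ ?_
  · -- `𝓜 ⊆ Γ`
    rintro r ⟨μ, hr, -⟩
    rcases hr with rfl | rfl
    · exact hρmem _
    · exact Subgroup.inv_mem _ (hρmem _)
  · -- `Γ ≤ closure 𝓜`: Zariski–van Kampen through `φ` and `ρ`
    have hclos := closure_meridian_loopClasses_eq_top hDirr (χ s₀)
    have hclos' : Subgroup.closure (φ '' {c | ∃ μ : Meridian ![D] (χ s₀) 0, c = μ.loopClass}) = ⊤ := by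
      rw [← MonoidHom.map_closure, hclos, ← MonoidHom.range_eq_map, MonoidHom.range_eq_top.mpr hφsurj]
    intro g hg
    rw [← hrange] at hg
    obtain ⟨c, rfl⟩ := hg
    have hc : c ∈ Subgroup.closure (φ '' {c | ∃ μ : Meridian ![D] (χ s₀) 0, c = μ.loopClass}) := by
      rw [hclos']; exact Subgroup.mem_top c
    have hmap : ρ c ∈ (Subgroup.closure (φ '' {c | ∃ μ : Meridian ![D] (χ s₀) 0, c = μ.loopClass})).map ρ :=
      Subgroup.mem_map_of_mem ρ hc
    rw [MonoidHom.map_closure] at hmap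
    refine (Subgroup.closure_le _).mpr ?_ hmap
    rintro _ ⟨_, ⟨_, ⟨μ, rfl⟩, rfl⟩, rfl⟩
    obtain ⟨r, δ, hr, hrest⟩ := hmer μ
    have hr𝓜 : r ∈ 𝓜 := ⟨μ, hr, δ, hrest⟩
    rcases hr with hr | hr
    · rw [← hr]; exact Subgroup.subset_closure hr𝓜
    · have : ρ (φ μ.loopClass) = r⁻¹ := by rw [hr, inv_inv]
      rw [this]; exact Subgroup.inv_mem _ (Subgroup.subset_closure hr𝓜)
  · -- any two meridian reflections are conjugate up to inversion (meridian conjugacy)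
    rintro r₁ ⟨μ₁, hr₁, -⟩ r₂ ⟨μ₂, hr₂, -⟩
    have hconj := affineHypersurfaceComplement_meridian_isConj_holds (TernaryIndex p) 1 ![D] hirr (χ s₀) 0 μ₁ μ₂
    obtain ⟨c, hc⟩ := isConj_iff.mp hconj
    have hT : ρ (φ μ₂.loopClass) = ρ (φ c) * ρ (φ μ₁.loopClass) * (ρ (φ c))⁻¹ := by
      rw [← hc, map_mul, map_mul, map_inv, map_mul, map_mul, map_inv]
    refine ⟨ρ (φ c), hρmem _, ?_⟩
    rcases hr₁ with rfl | rfl <;> rcases hr₂ with rfl | rfl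
    · exact Or.inl hT
    · right; rw [hT]; simp only [mul_inv_rev, inv_inv, mul_assoc]
    · right; rw [hT, inv_inv]
    · left; rw [hT]; simp only [mul_inv_rev, inv_inv, mul_assoc]
  · -- the local Picard–Lefschetz content (H1)
    rintro r ⟨μ, -, δ, hrest⟩
    exact ⟨δ, hrest⟩
  · -- monodromy invariants are `τ`-invariant (H2)
    exact fun x hx => H2 hodd h3 f hf hf0 hX e he τ hτ x hx

/-- **The bundled cited fact `nonempty_carlsonToledoFamily` (the registered binder `stub_carlsonToledoFamily` of
crux K1 via `CyclicUnitaryPowersFourFactsPL`/`ThreePrintFacts`) from the two meridian facts.** CONDITIONAL.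
[cite: CarlsonToledo1999, §2, §3, §6 Proposition, §7 last paragraph] -/
theorem nonempty_carlsonToledoFamily_of_meridian_facts
    (H1 : carlsonToledo1999_meridianMonodromy_isCyclicReflection)
    (H2 : carlsonToledo1999_monodromyInvariants_eq_deckInvariants) : nonempty_carlsonToledoFamily :=
  nonempty_carlsonToledoFamily_of_cyclicReflectionSystem
    (carlsonToledo1999_cyclicReflectionSystem_of_meridian_facts H1 H2)

end Assembly

/-! ### §5 Crux K1 and the rung leaf modulo the four local/print facts -/

section Crux

/-- **Crux K1 `VeryGeneralDeckCommutatorsInHg` modulo FOUR cited facts of local/print content**: the meridian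
local monodromy (CT99 §1 + §6 Prop.), the invariant cycles of the cyclic family (CT99 §3 ¶2, Deligne 4.1.1), the
eigen-Hodge numbers (CT99 §5; a theorem modulo Griffiths' residue kernel, `CyclicUnitaryPowersDeckHodgeOfGriffiths`)
and the CDK cover — the bundled Picard–Lefschetz package `carlsonToledo1999_cyclicReflectionSystem` of
`CyclicUnitaryPowersThreePrintFacts` being now DERIVED (§4). CONDITIONAL; nothing here says HC ∕ HC_AV is proved.
[cite: CarlsonToledo1999, §1, §3, §5, §6 Proposition] [cite: CattaniDeligneKaplan1995, Thm. 1.1 and Cor. 1.2] -/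
theorem veryGeneralDeckCommutatorsInHg_of_meridian_facts
    (H1 : carlsonToledo1999_meridianMonodromy_isCyclicReflection)
    (H2 : carlsonToledo1999_monodromyInvariants_eq_deckInvariants)
    (hCT2 : carlsonToledo1999_finrank_eigenspace_inf_hodgePiece)
    (hCDK : cmsp_nonHodgeGenericPoints_countable_algebraic_cover) :
    Summit.HodgeConjecture.HodgeConjecture.Theses.CyclicUnitaryPowers.VeryGeneralDeckCommutatorsInHg :=
  CyclicUnitaryPowersThreePrintFacts.veryGeneralDeckCommutatorsInHg_of_three_print_facts
    (carlsonToledo1999_cyclicReflectionSystem_of_meridian_facts H1 H2) @hCT2 @hCDK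

/-- **The rung-F-H1 leaf `CyclicSurfacePowersHodge` modulo the same four facts.** CONDITIONAL; rung F-H1 not moved.
[cite: CarlsonToledo1999, §1, §3, §5, §6 Proposition] [cite: CattaniDeligneKaplan1995, Thm. 1.1 and Cor. 1.2] -/
theorem cyclicSurfacePowersHodge_of_meridian_facts
    (H1 : carlsonToledo1999_meridianMonodromy_isCyclicReflection)
    (H2 : carlsonToledo1999_monodromyInvariants_eq_deckInvariants)
    (hCT2 : carlsonToledo1999_finrank_eigenspace_inf_hodgePiece)
    (hCDK : cmsp_nonHodgeGenericPoints_countable_algebraic_cover) :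
    Summit.HodgeConjecture.HodgeConjecture.Theses.CyclicUnitaryPowers.CyclicSurfacePowersHodge :=
  CyclicUnitaryPowersThreePrintFacts.cyclicSurfacePowersHodge_of_three_print_facts
    (carlsonToledo1999_cyclicReflectionSystem_of_meridian_facts H1 H2) @hCT2 @hCDK

end Crux

end Summit.HodgeConjecture.HodgeConjecture.Theorems.CyclicUnitaryPowersPLPackageOfMeridians

end
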